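import Summits.Ventures.HodgeRepro2.T5SU11LegendreSeries

/-!
# Termwise integration of the Legendre series of a continuous function:
`∫_{−1}^{x} f = c_0(f)(x + 1) + Σ_{k≥1} c_k(f) (P_{k+1}(x) − P_{k−1}(x))/(2k + 1)`, uniformly on `[−1, 1]`

No smoothness is needed: for every `f` continuous on `[−1, 1]` the `L²`-convergence `∫ (f − S_d f)² → 0` of row 420
and the elementary `L¹`-`L²` bound `(∫ |g|)² ≤ 2 ∫ g²` (`sq_integral_abs_le`) give

  **`∫_{−1}^{x} S_d f → ∫_{−1}^{x} f` uniformly in `x ∈ [−1, 1]`**   (`tendstoUniformlyOn_integral_partialSum`),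

and `∫_{−1}^{x} P_k = (P_{k+1}(x) − P_{k−1}(x))/(2k + 1)` for `k ≥ 1` (row 378) turns the integrated partial sum into
the explicit polynomial `c_0 (x + 1) + Σ_{1≤k≤d} c_k (P_{k+1}(x) − P_{k−1}(x))/(2k + 1)`
(`integral_partialSum_eq`), so the integrated Legendre series converges uniformly on `[−1, 1]` to the primitive
`∫_{−1}^{x} f` (`tendsto_integratedSum`). Nothing is claimed about (N).

Blind lane: Mathlib + the HodgeRepro2 prefix only; no sorry; axioms ⊆ {propext, Classical.choice,
Quot.sound}.
-/

namespace Summit.Ventures.HodgeRepro2.T5SU11LegendreSeriesIntegrate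

open Polynomial intervalIntegral Finset Filter Topology MeasureTheory
open Set (Icc Ioc Ioo uIcc uIoc)
open T5SU11SphericalLegendreAll T5SU11SphericalLegendreLaplace T5SU11LegendreIdentities T5SU11LegendreOrthogonal
  T5SU11LegendreSeries

/-! ### The `L¹`–`L²` bound and the bound on partial integrals -/

/-- **`(∫_{−1}^{1} |g|)² ≤ 2 ∫_{−1}^{1} g²`** for `g` continuous on `[−1, 1]` (the discriminant of
`0 ≤ ∫ (|g| − t)² = ∫ g² − 2t ∫ |g| + 2t²` at `t = ½ ∫ |g|`). -/
theorem sq_integral_abs_le {g : ℝ → ℝ} (hg : ContinuousOn g (Icc (-1 : ℝ) 1)) :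
    (∫ x in (-1 : ℝ)..1, |g x|) ^ 2 ≤ 2 * ∫ x in (-1 : ℝ)..1, g x ^ 2 := by
  set A := ∫ x in (-1 : ℝ)..1, g x ^ 2 with hA
  set B := ∫ x in (-1 : ℝ)..1, |g x| with hB
  have i1 : IntervalIntegrable (fun x => g x ^ 2) volume (-1 : ℝ) 1 :=
    (hg.pow 2).intervalIntegrable_of_Icc (by norm_num)
  have i2 : IntervalIntegrable (fun x => |g x|) volume (-1 : ℝ) 1 :=
    hg.abs.intervalIntegrable_of_Icc (by norm_num)
  have hquad : 0 ≤ A - 2 * (B / 2) * B + 2 * (B / 2) ^ 2 := by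
    have h0 : 0 ≤ ∫ x in (-1 : ℝ)..1, (|g x| - B / 2) ^ 2 :=
      integral_nonneg (by norm_num) fun x _ => sq_nonneg _
    have e : ∀ x, (|g x| - B / 2) ^ 2 = g x ^ 2 - (2 * (B / 2)) * |g x| + (B / 2) ^ 2 := fun x => by
      rw [sub_sq, sq_abs]
      ring
    simp_rw [e] at h0
    rw [integral_add (i1.sub (i2.const_mul _)) intervalIntegrable_const, integral_sub i1 (i2.const_mul _),
      intervalIntegral.integral_const_mul, intervalIntegral.integral_const] at h0
    simp only [sub_neg_eq_add, smul_eq_mul] at h0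
    linarith
  nlinarith [hquad]

/-- `|∫_{−1}^{x} g| ≤ ∫_{−1}^{1} |g|` for `x ∈ [−1, 1]` and `g` continuous on `[−1, 1]`. -/
theorem abs_integral_le_integral_abs' {g : ℝ → ℝ} (hg : ContinuousOn g (Icc (-1 : ℝ) 1)) {x : ℝ}
    (hx : x ∈ Icc (-1 : ℝ) 1) : |∫ t in (-1 : ℝ)..x, g t| ≤ ∫ t in (-1 : ℝ)..1, |g t| := by
  have i2 : IntervalIntegrable (fun x => |g x|) volume (-1 : ℝ) 1 :=
    hg.abs.intervalIntegrable_of_Icc (by norm_num)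
  calc |∫ t in (-1 : ℝ)..x, g t| ≤ ∫ t in (-1 : ℝ)..x, |g t| := abs_integral_le_integral_abs hx.1
    _ ≤ ∫ t in (-1 : ℝ)..1, |g t| :=
        integral_mono_interval le_rfl hx.1 hx.2 (Filter.Eventually.of_forall fun t => abs_nonneg _) i2

/-- **`|∫_{−1}^{x} g| ≤ √2 · √(∫_{−1}^{1} g²)`** on `[−1, 1]`. -/
theorem abs_integral_le_sqrt {g : ℝ → ℝ} (hg : ContinuousOn g (Icc (-1 : ℝ) 1)) {x : ℝ}
    (hx : x ∈ Icc (-1 : ℝ) 1) :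
    |∫ t in (-1 : ℝ)..x, g t| ≤ Real.sqrt 2 * Real.sqrt (∫ t in (-1 : ℝ)..1, g t ^ 2) := by
  refine (abs_integral_le_integral_abs' hg hx).trans ?_
  have hB : 0 ≤ ∫ t in (-1 : ℝ)..1, |g t| := integral_nonneg (by norm_num) fun t _ => abs_nonneg _
  rw [← Real.sqrt_mul (by norm_num), ← Real.sqrt_sq hB]
  exact Real.sqrt_le_sqrt (sq_integral_abs_le hg)

/-! ### The integrated partial sums -/

/-- `∫_{−1}^{x} P_0 = x + 1`. -/
theorem integral_legP_zero (x : ℝ) : ∫ t in (-1 : ℝ)..x, legP 0 t = x + 1 := by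
  simp only [legP_zero, intervalIntegral.integral_const, smul_eq_mul, mul_one]
  ring

/-- `∫_{−1}^{x} P_{k+1} = (P_{k+2}(x) − P_k(x))/(2k + 3)` (row 378; the boundary term at `−1` vanishes). -/
theorem integral_legP_succ_eq (k : ℕ) (x : ℝ) :
    ∫ t in (-1 : ℝ)..x, legP (k + 1) t = (legP (k + 2) x - legP k x) / (2 * (k : ℝ) + 3) := by
  rw [integral_legP_succ, legP_neg_one, legP_neg_one, pow_succ, pow_succ]
  ring

/-- **The integrated partial sum in closed form**:
`∫_{−1}^{x} S_d f = c_0(f)(x + 1) + Σ_{k<d} c_{k+1}(f) (P_{k+2}(x) − P_k(x))/(2k + 3)`. -/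
theorem integral_partialSum_eq (f : ℝ → ℝ) (d : ℕ) (x : ℝ) :
    ∫ t in (-1 : ℝ)..x, partialSum f d t
      = fourierLegendre f 0 * (x + 1)
        + ∑ k ∈ range d, fourierLegendre f (k + 1) * ((legP (k + 2) x - legP k x) / (2 * (k : ℝ) + 3)) := by
  have hint : ∀ k ∈ range (d + 1), IntervalIntegrable (fun t => fourierLegendre f k * legP k t) volume (-1 : ℝ) x :=
    fun k _ => (continuous_const.mul (continuous_legP k)).intervalIntegrable _ _
  simp only [partialSum]
  rw [integral_finsetSum hint, Finset.sum_range_succ', intervalIntegral.integral_const_mul, integral_legP_zero,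
    add_comm]
  congr 1
  refine Finset.sum_congr rfl fun k _ => ?_
  rw [intervalIntegral.integral_const_mul, integral_legP_succ_eq]

/-! ### Uniform convergence of the integrated series -/

/-- **Termwise integration**: `∫_{−1}^{x} S_d f → ∫_{−1}^{x} f` uniformly in `x ∈ [−1, 1]` for every `f`
continuous on `[−1, 1]` (row 420's `L²`-convergence and the `L¹`–`L²` bound). -/
theorem tendstoUniformlyOn_integral_partialSum {f : ℝ → ℝ} (hf : ContinuousOn f (Icc (-1 : ℝ) 1)) :
    TendstoUniformlyOn (fun d x => ∫ t in (-1 : ℝ)..x, partialSum f d t) (fun x => ∫ t in (-1 : ℝ)..x, f t)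
      atTop (Icc (-1 : ℝ) 1) := by
  rw [Metric.tendstoUniformlyOn_iff]
  intro ε hε
  have hL2 := tendsto_integral_sub_partialSum_sq hf
  -- choose `d` with `√2 · √(∫ (f − S_d f)²) < ε`
  have hlim : Tendsto (fun d => Real.sqrt 2 * Real.sqrt (∫ x in (-1 : ℝ)..1, (f x - partialSum f d x) ^ 2))
      atTop (𝓝 (Real.sqrt 2 * Real.sqrt 0)) := (hL2.sqrt).const_mul _
  rw [Real.sqrt_zero, mul_zero] at hlim
  filter_upwards [(tendsto_order.1 hlim).2 ε hε] with d hd x hx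
  have hcont : ContinuousOn (fun t => f t - partialSum f d t) (Icc (-1 : ℝ) 1) :=
    hf.sub (continuous_partialSum f d).continuousOn
  have hi1 : IntervalIntegrable f volume (-1 : ℝ) x :=
    (hf.mono (Set.Icc_subset_Icc le_rfl hx.2)).intervalIntegrable_of_Icc hx.1
  have hi2 : IntervalIntegrable (partialSum f d) volume (-1 : ℝ) x :=
    (continuous_partialSum f d).intervalIntegrable _ _
  rw [Real.dist_eq, ← integral_sub hi1 hi2]
  exact lt_of_le_of_lt (abs_integral_le_sqrt hcont hx) hd

/-- Pointwise: `∫_{−1}^{x} S_d f → ∫_{−1}^{x} f` for every `x ∈ [−1, 1]`. -/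
theorem tendsto_integral_partialSum {f : ℝ → ℝ} (hf : ContinuousOn f (Icc (-1 : ℝ) 1)) {x : ℝ}
    (hx : x ∈ Icc (-1 : ℝ) 1) :
    Tendsto (fun d => ∫ t in (-1 : ℝ)..x, partialSum f d t) atTop (𝓝 (∫ t in (-1 : ℝ)..x, f t)) :=
  (tendstoUniformlyOn_integral_partialSum hf).tendsto_at hx

/-- **THE INTEGRATED LEGENDRE SERIES**: for every `f` continuous on `[−1, 1]` and every `x ∈ [−1, 1]`,
`c_0(f)(x + 1) + Σ_{k<d} c_{k+1}(f) (P_{k+2}(x) − P_k(x))/(2k + 3) → ∫_{−1}^{x} f` as `d → ∞`. -/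
theorem tendsto_integratedSum {f : ℝ → ℝ} (hf : ContinuousOn f (Icc (-1 : ℝ) 1)) {x : ℝ}
    (hx : x ∈ Icc (-1 : ℝ) 1) :
    Tendsto (fun d => fourierLegendre f 0 * (x + 1)
        + ∑ k ∈ range d, fourierLegendre f (k + 1) * ((legP (k + 2) x - legP k x) / (2 * (k : ℝ) + 3)))
      atTop (𝓝 (∫ t in (-1 : ℝ)..x, f t)) := by
  have h := tendsto_integral_partialSum hf hx
  simp_rw [integral_partialSum_eq] at h
  exact h

/-- The integrated series converges uniformly on `[−1, 1]` (the `TendstoUniformlyOn` form). -/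
theorem tendstoUniformlyOn_integratedSum {f : ℝ → ℝ} (hf : ContinuousOn f (Icc (-1 : ℝ) 1)) :
    TendstoUniformlyOn (fun d x => fourierLegendre f 0 * (x + 1)
        + ∑ k ∈ range d, fourierLegendre f (k + 1) * ((legP (k + 2) x - legP k x) / (2 * (k : ℝ) + 3)))
      (fun x => ∫ t in (-1 : ℝ)..x, f t) atTop (Icc (-1 : ℝ) 1) := by
  have h := tendstoUniformlyOn_integral_partialSum hf
  simp_rw [integral_partialSum_eq] at h
  exact h

end Summit.Ventures.HodgeRepro2.T5SU11LegendreSeriesIntegrate
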